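import Literature.NumberTheory.EllipticCurves.DeShalit1987.KatzObjectValue
import Literature.NumberTheory.EllipticCurves.ProfiniteGroupDistributionLevelDecides
import HarnessLib

set_option autoImplicit false

/-!
# Road A″ (child crux 27851 `SplitBadTwoLowerHalfOfFacts`): the value receptacle `DeShalit1987.MeasureValue` AT FINITE
# LEVEL — its MASS FORM on every witness (an EQUIVALENCE), the column form under a Riemann-sum factorisation, and
# the three-factor frame threshold

Cell `bsd-print-cf2`, discharge-interface typer `bsd-print-cf2-ty2` g46 (literature-prover seat; Summits-side helpers in the
typer's directory `Rank1Residual/P2/`, Theses-free, no item): port **P61 (d)** of STUB-PLAN `stub_heegnerIndexLowerAtTwo` v7.9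
(crux `PrintCf2.SplitBadTwoLowerHalfOfFacts`, stmt-BirchSwinnertonDyer-27851; row 128 = R225-EQ «THE RECEPTACLE AND THE COLUMN AT
FINITE LEVEL», critic rows `CRITIC-ROWS-g44.md` rev 4; sketch k1-g42 `a2cbc91c41538373` §2/§4/§5), written against the TREE's
receptacle `Literature.NumberTheory.EllipticCurves.DeShalit1987.MeasureValue` (P54, `DeShalit1987/KatzObjectValue.lean`) and the
tree's «level decides» lemmas (`ProfiniteGroupDistributionLevelDecides.lean`, P61 (a)).  HONEST FRAMING: glue only — the five
`def`s below are RECEPTACLES WITH EXPLICIT BINDERS (glue predicates; nothing is asserted, no named fact), every `theorem` is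
proved; nothing here proves BSD, the crux, the stub, or HARDEST (a)/(b); no summit statement is proved by this file; no `sorry`.

* §1 `OnWitnesses ι v v̄ Sθ Extra Q` — the common binder prefix of `MeasureValue` («for every admissible period triple and every
  witness `(𝒰, μ)` of the shape of II Thm. 4.14 at `Sθ` carrying `Extra`, `Q 𝒰 μ`»); `measureValue_iff_onWitnesses` (`Iff.rfl`);
  `FrameContinuous` (the frame integrand `r·l` is tower-continuous on every witness tower); ★ `MassValue … r l ε` — «on every
  witness there is a level `N` from which `r·l` oscillates by `≤ ε` on cells and whose level-`N` TWISTED MASS SUM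
  `Σ_a μ_N(a)·(r·l)(repr a)` has norm `≤ ε`»; ★★ `measureValue_iff_massValue` (`ε > 0`): PIECE 3 of the cut at `P := (‖·‖ ≤ ε)`
  ⟺ its mass form — the weakest sufficient AND strongest necessary finite-level statement; `measureValue_two_pow_iff_massValue`
  (the stub's instance `ε = 2^{−M/2}`).  Composes BY NAME with `RubinValueTwoLowerMeasure.lower_two_of_DGal_of_subsetForall_of_measureValue`
  (P55, `PrintCf2RubinValueTwoLowerOfMeasureValue.lean`) through `measureValue_of_massValue`.
* §2 the three-factor threshold at the frame character (norms only): `norm_le_iff_of_eq_const_mul`, `norm_frameConst`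
  (`‖(a·b)⁻¹·g‖ = 2^{2 + s + n/2}` from `‖a‖ = ¼`, `‖b‖ = 2^{−s}`, `‖g‖ = 2^{n/2}`), ★ `frame_threshold`
  (`‖val‖ ≤ 2^{−M/2} ↔ ‖u‖ ≤ 2^{−(M/2 + 2 + s + n/2)}` for `val = (a·b)⁻¹·g·u`).
* §3 `RiemannSumFactorisation D f c S N` / `…UpTo … η` (receptacles: from level `N` on, `RS_m f = c·S m`, resp. up to `η`) and
  ★ `norm_integral_le_iff_column[_upTo]`: `‖∫ f dD‖ ≤ ε ↔ ∀ m ≥ max N₁ N₂, ‖S m‖ ≤ ε/‖c‖` (ultrametric; the error term is absorbed).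

References: [deShalit1987] I.3.1 (p. 16), II Thm. 4.14 (36) (p. 71), II.4.16 (49)–(50) (p. 76–77), II.5.2 (4) (p. 79).
-/

noncomputable section

open scoped Classical
open Filter Topology
open NumberField IsDedekindDomain Field
open Literature.NumberTheory.GaloisRepresentations
open Literature.NumberTheory.EllipticCurves
open Literature.NumberTheory.EllipticCurves.DeShalit1987

namespace Summit.BirchSwinnertonDyer.Rank1Residual.P2.FiniteLevel

/-! ## §1 The receptacle of record and its MASS FORM on every witness -/

section Frame

variable {p : ℕ} [Fact p.Prime] {K : Type} [Field K] [NumberField K]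

/-- **«on every witness at `Sθ` carrying `Extra`, `Q 𝒰 μ`»** — the common binder prefix of `DeShalit1987.MeasureValue`,
abstracted so that the mass form and the continuity datum are stated ONCE.  A receptacle with explicit binders (glue
predicate) — nothing is asserted. -/
def OnWitnesses (ι : PadicAlgCl p ≃+* ℂ) (v vbar : HeightOneSpectrum (𝓞 K)) (Sθ : Finset (HeightOneSpectrum (𝓞 K)))
    (Extra : Finset (HeightOneSpectrum (𝓞 K)) → (𝒰 : SubgroupTower (absoluteGaloisGroup K)) →
      GroupDistribution 𝒰 ℂ_[p] → Prop)
    (Q : (𝒰 : SubgroupTower (absoluteGaloisGroup K)) → GroupDistribution 𝒰 ℂ_[p] → Prop) : Prop :=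
  ∀ (Ω δ : ℂ) (Ωp : (unrIntegers p)ˣ) (𝒰 : SubgroupTower (absoluteGaloisGroup K)) (μ : GroupDistribution 𝒰 ℂ_[p]),
    (∀ n, IsOpen (𝒰.U n : Set (absoluteGaloisGroup K))) →
    (⋂ n, (𝒰.U n : Set (absoluteGaloisGroup K))) ⊆ DeShalit1987.rayKer K p Sθ → μ.bound ≤ 1 →
    DeShalit1987.IsLMeasure ι v vbar Sθ Ω δ ((Ωp : unrIntegers p) : ℂ_[p]) 𝒰 μ → Extra Sθ 𝒰 μ → Q 𝒰 μ

variable {ι : PadicAlgCl p ≃+* ℂ} {v vbar : HeightOneSpectrum (𝓞 K)} {Sθ : Finset (HeightOneSpectrum (𝓞 K))}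
  {Extra : Finset (HeightOneSpectrum (𝓞 K)) → (𝒰 : SubgroupTower (absoluteGaloisGroup K)) →
    GroupDistribution 𝒰 ℂ_[p] → Prop}
  {r l : FramedGaloisRep K (PadicAlgCl p) 1}

/-- `DeShalit1987.MeasureValue … r l P` is `OnWitnesses` at `Q := P (∫ r·l dμ)` — definitional. -/
theorem measureValue_iff_onWitnesses (P : ℂ_[p] → Prop) :
    MeasureValue ι v vbar Sθ Extra r l P ↔
      OnWitnesses ι v vbar Sθ Extra (fun _ μ ↦ P (μ.integral fun σ ↦ avatarValueAt r σ * avatarValueAt l σ)) :=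
  Iff.rfl

/-- `OnWitnesses` is MONOTONE in `Q`. -/
theorem OnWitnesses.mono {Q Q' : (𝒰 : SubgroupTower (absoluteGaloisGroup K)) → GroupDistribution 𝒰 ℂ_[p] → Prop}
    (hQ : ∀ 𝒰 μ, Q 𝒰 μ → Q' 𝒰 μ) (h : OnWitnesses ι v vbar Sθ Extra Q) : OnWitnesses ι v vbar Sθ Extra Q' :=
  fun Ω δ Ωp 𝒰 μ hU hN hb hL hE ↦ hQ 𝒰 μ (h Ω δ Ωp 𝒰 μ hU hN hb hL hE)

/-- Two `OnWitnesses` data combine. -/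
theorem OnWitnesses.and {Q Q' : (𝒰 : SubgroupTower (absoluteGaloisGroup K)) → GroupDistribution 𝒰 ℂ_[p] → Prop}
    (h : OnWitnesses ι v vbar Sθ Extra Q) (h' : OnWitnesses ι v vbar Sθ Extra Q') :
    OnWitnesses ι v vbar Sθ Extra (fun 𝒰 μ ↦ Q 𝒰 μ ∧ Q' 𝒰 μ) :=
  fun Ω δ Ωp 𝒰 μ hU hN hb hL hE ↦ ⟨h Ω δ Ωp 𝒰 μ hU hN hb hL hE, h' Ω δ Ωp 𝒰 μ hU hN hb hL hE⟩

/-- **The frame integrand is tower-continuous on every witness tower** (dischargeable from `DeShalit1987.FrameData`: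
`r` through the `ℤ_p²`-pair, `l` an avatar of `θ_K⁻¹`, `⋂ U_n ⊆ rayKer`).  A receptacle with explicit binders (glue
predicate) — nothing is asserted. -/
def FrameContinuous (ι : PadicAlgCl p ≃+* ℂ) (v vbar : HeightOneSpectrum (𝓞 K))
    (Sθ : Finset (HeightOneSpectrum (𝓞 K)))
    (Extra : Finset (HeightOneSpectrum (𝓞 K)) → (𝒰 : SubgroupTower (absoluteGaloisGroup K)) →
      GroupDistribution 𝒰 ℂ_[p] → Prop)
    (r l : FramedGaloisRep K (PadicAlgCl p) 1) : Prop :=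
  OnWitnesses ι v vbar Sθ Extra (fun 𝒰 _ ↦ 𝒰.IsTowerContinuous fun σ ↦ avatarValueAt r σ * avatarValueAt l σ)

/-- **MASS FORM of the value receptacle** — «on every witness there is a level `N` from which `r·l` oscillates by `≤ ε`
on cells and whose level-`N` TWISTED MASS SUM `Σ_a μ_N(a)·(r·l)(repr a)` has norm `≤ ε`» (`N` may depend on the witness,
whose tower it lives on).  A receptacle with explicit binders (glue predicate) — nothing is asserted. -/
def MassValue (ι : PadicAlgCl p ≃+* ℂ) (v vbar : HeightOneSpectrum (𝓞 K)) (Sθ : Finset (HeightOneSpectrum (𝓞 K)))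
    (Extra : Finset (HeightOneSpectrum (𝓞 K)) → (𝒰 : SubgroupTower (absoluteGaloisGroup K)) →
      GroupDistribution 𝒰 ℂ_[p] → Prop)
    (r l : FramedGaloisRep K (PadicAlgCl p) 1) (ε : ℝ) : Prop :=
  OnWitnesses ι v vbar Sθ Extra fun 𝒰 μ ↦ ∃ N : ℕ,
    (∀ n, N ≤ n → ∀ σ τ : absoluteGaloisGroup K, 𝒰.proj n σ = 𝒰.proj n τ →
      ‖avatarValueAt r σ * avatarValueAt l σ - avatarValueAt r τ * avatarValueAt l τ‖ ≤ ε) ∧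
    ‖μ.riemannSum (fun σ ↦ avatarValueAt r σ * avatarValueAt l σ) N‖ ≤ ε

/-- **MASS FORM ⟹ the receptacle** at `P := (‖·‖ ≤ ε)` (kernel; `GroupDistribution.norm_integral_le_of_riemannSum`). -/
theorem measureValue_of_massValue {ε : ℝ} (hε : 0 ≤ ε) (hcont : FrameContinuous ι v vbar Sθ Extra r l)
    (h : MassValue ι v vbar Sθ Extra r l ε) :
    MeasureValue ι v vbar Sθ Extra r l (fun z ↦ ‖z‖ ≤ ε) := by
  intro Ω δ Ωp 𝒰 μ hU hN hb hL hE
  obtain ⟨N, hosc, hRS⟩ := h Ω δ Ωp 𝒰 μ hU hN hb hL hE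
  exact μ.norm_integral_le_of_riemannSum (hcont Ω δ Ωp 𝒰 μ hU hN hb hL hE) hb hε hosc le_rfl hRS

/-- **The receptacle ⟹ MASS FORM** (kernel; `GroupDistribution.norm_riemannSum_le_of_integral`): the mass form is also
NECESSARY — it is the weakest sufficient AND the strongest necessary finite-level statement. -/
theorem massValue_of_measureValue {ε : ℝ} (hε : 0 < ε) (hcont : FrameContinuous ι v vbar Sθ Extra r l)
    (h : MeasureValue ι v vbar Sθ Extra r l (fun z ↦ ‖z‖ ≤ ε)) :
    MassValue ι v vbar Sθ Extra r l ε := by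
  intro Ω δ Ωp 𝒰 μ hU hN hb hL hE
  have hf := hcont Ω δ Ωp 𝒰 μ hU hN hb hL hE
  obtain ⟨N, hosc⟩ := hf.exists_forall_norm_sub_le hε
  exact ⟨N, hosc, μ.norm_riemannSum_le_of_integral hf hb hε.le hosc (h Ω δ Ωp 𝒰 μ hU hN hb hL hE) le_rfl⟩

/-- ★★ **The receptacle ⟺ its MASS FORM** for `ε > 0` (in the stub: `ε = 2^{−M/2}`). -/
theorem measureValue_iff_massValue {ε : ℝ} (hε : 0 < ε) (hcont : FrameContinuous ι v vbar Sθ Extra r l) :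
    MeasureValue ι v vbar Sθ Extra r l (fun z ↦ ‖z‖ ≤ ε) ↔ MassValue ι v vbar Sθ Extra r l ε :=
  ⟨massValue_of_measureValue hε hcont, measureValue_of_massValue hε.le hcont⟩

omit [NumberField K] in
/-- The frame integrand is multiplicative (so `GroupDistribution.integral_twist_eq` / `riemannSum_twist_eq` apply to it
exactly as to `χ̂⁻¹`). -/
theorem frameIntegrand_mul (σ τ : absoluteGaloisGroup K) :
    avatarValueAt r (σ * τ) * avatarValueAt l (σ * τ) =
      (avatarValueAt r σ * avatarValueAt l σ) * (avatarValueAt r τ * avatarValueAt l τ) := by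
  rw [avatarValueAt_mul, avatarValueAt_mul]; ring

/-- **The stub's instance**: the receptacle at `P := (‖·‖ ≤ 2^{−M/2})` ⟺ the mass form at `ε = 2^{−M/2}`. -/
theorem measureValue_two_pow_iff_massValue (M : ℤ) (hcont : FrameContinuous ι v vbar Sθ Extra r l) :
    MeasureValue ι v vbar Sθ Extra r l (fun z ↦ ‖z‖ ≤ (2 : ℝ) ^ (-(M : ℝ) / 2)) ↔
      MassValue ι v vbar Sθ Extra r l ((2 : ℝ) ^ (-(M : ℝ) / 2)) :=
  measureValue_iff_massValue (Real.rpow_pos_of_pos (by norm_num) _) hcont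

/-- `MassValue` is ANTITONE in `Extra` (as `MeasureValue` is: `DeShalit1987.measureValue_anti`). -/
theorem massValue_anti
    {Extra' : Finset (HeightOneSpectrum (𝓞 K)) → (𝒰 : SubgroupTower (absoluteGaloisGroup K)) →
      GroupDistribution 𝒰 ℂ_[p] → Prop}
    (hE : ∀ S 𝒰 μ, Extra' S 𝒰 μ → Extra S 𝒰 μ) {ε : ℝ} (h : MassValue ι v vbar Sθ Extra r l ε) :
    MassValue ι v vbar Sθ Extra' r l ε :=
  fun Ω δ Ωp 𝒰 μ hU hN hb hL hE' ↦ h Ω δ Ωp 𝒰 μ hU hN hb hL (hE _ _ _ hE')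

end Frame

/-! ## §2 The three-factor threshold at the frame character (norms only) -/

section Threshold

variable {𝕜 : Type*} [NormedField 𝕜]

/-- `val = c·u`, `c ≠ 0`: `‖val‖ ≤ t ↔ ‖u‖ ≤ t/‖c‖`. -/
theorem norm_le_iff_of_eq_const_mul {val c u : 𝕜} (h : val = c * u) (hc : c ≠ 0) (t : ℝ) :
    ‖val‖ ≤ t ↔ ‖u‖ ≤ t / ‖c‖ := by
  rw [h, norm_mul, le_div_iff₀ (norm_pos_iff.mpr hc), mul_comm]

/-- **The constant of the frame-level Kronecker formula has norm `2^{2 + s + n/2}`**: smoothing `a = 12` (`‖12‖₂ = ¼`),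
`b = (r·l)(σ_𝔞)⁻¹ − N𝔞` of norm `2^{−s}` (smoothing digit), Gauss factor `g` of norm `2^{n/2}`. -/
theorem norm_frameConst {a b g : 𝕜} {s n : ℝ} (ha : ‖a‖ = 4⁻¹) (hb : ‖b‖ = (2 : ℝ) ^ (-s))
    (hg : ‖g‖ = (2 : ℝ) ^ (n / 2)) : ‖(a * b)⁻¹ * g‖ = (2 : ℝ) ^ (2 + s + n / 2) := by
  rw [norm_mul, norm_inv, norm_mul, ha, hb, hg]
  have h4 : (4 : ℝ)⁻¹ = (2 : ℝ) ^ (-(2 : ℝ)) := by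
    rw [Real.rpow_neg (by norm_num : (0:ℝ) ≤ 2), Real.rpow_two]; norm_num
  rw [h4, ← Real.rpow_add (by norm_num : (0:ℝ) < 2), ← Real.rpow_neg (by norm_num : (0:ℝ) ≤ 2),
    ← Real.rpow_add (by norm_num : (0:ℝ) < 2)]
  congr 1; ring

/-- ★ **FRAME THRESHOLD** (one-sided): for `val = (a·b)⁻¹·g·u` with the three digits,
`‖val‖ ≤ 2^{−M/2}` iff the unit-log LIMIT column `u` has `‖u‖ ≤ 2^{−(M/2 + 2 + s + n/2)}`. -/
theorem frame_threshold {val a b g u : 𝕜} {s n M : ℝ} (h : val = (a * b)⁻¹ * g * u)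
    (ha : ‖a‖ = 4⁻¹) (hb : ‖b‖ = (2 : ℝ) ^ (-s)) (hg : ‖g‖ = (2 : ℝ) ^ (n / 2))
    (hab : a * b ≠ 0) (hg0 : g ≠ 0) :
    ‖val‖ ≤ (2 : ℝ) ^ (-M / 2) ↔ ‖u‖ ≤ (2 : ℝ) ^ (-(M / 2 + 2 + s + n / 2)) := by
  rw [norm_le_iff_of_eq_const_mul h (mul_ne_zero (inv_ne_zero hab) hg0), norm_frameConst ha hb hg,
    ← Real.rpow_sub (by norm_num : (0:ℝ) < 2)]
  have : -M / 2 - (2 + s + n / 2) = -(M / 2 + 2 + s + n / 2) := by ring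
  rw [this]

end Threshold

/-! ## §3 Factorised Riemann sums: the value bound as an eventual bound on FINITE columns -/

section Column

variable {G : Type*} [Group G] {𝒰 : SubgroupTower G} {𝕜 : Type*} [NormedField 𝕜]
  [CompleteSpace 𝕜] [IsUltrametricDist 𝕜]

/-- **Receptacle (producer's output shape): the frame-level Kronecker formula AT FINITE LEVEL** — from level `N` on, the
Riemann sums of `f` factor as a fixed constant `c` (smoothing⁻¹ × Gauss factor) times a «column» `S m` (the producer
instantiates `S m := Σ_{h ∈ cells m} f(repr h)·log j_p(h·u_m)` for ONE norm-coherent unit tower `u_m`).  A receptacle with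
explicit binders — nothing is asserted. -/
def RiemannSumFactorisation (D : GroupDistribution 𝒰 𝕜) (f : G → 𝕜) (c : 𝕜) (S : ℕ → 𝕜) (N : ℕ) : Prop :=
  ∀ m, N ≤ m → D.riemannSum f m = c * S m

/-- ★ **`‖∫ f dD‖ ≤ ε` ⟺ «eventually `‖S_m‖ ≤ ε/‖c‖`»** under a Riemann-sum factorisation (`D.bound ≤ 1`, `c ≠ 0`). -/
theorem norm_integral_le_iff_column (D : GroupDistribution 𝒰 𝕜) {f : G → 𝕜}
    (hf : 𝒰.IsTowerContinuous f) (hb : D.bound ≤ 1) {ε : ℝ} (hε : 0 ≤ ε) {N₁ : ℕ}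
    (hN : ∀ n, N₁ ≤ n → ∀ σ τ : G, 𝒰.proj n σ = 𝒰.proj n τ → ‖f σ - f τ‖ ≤ ε)
    {c : 𝕜} {S : ℕ → 𝕜} {N₂ : ℕ} (hfac : RiemannSumFactorisation D f c S N₂) (hc : c ≠ 0) :
    ‖D.integral f‖ ≤ ε ↔ ∀ m, max N₁ N₂ ≤ m → ‖S m‖ ≤ ε / ‖c‖ := by
  have hc' : 0 < ‖c‖ := norm_pos_iff.mpr hc
  constructor
  · intro hI m hm
    have hRS := D.norm_riemannSum_le_of_integral hf hb hε hN hI (le_of_max_le_left hm)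
    rw [hfac m (le_of_max_le_right hm), norm_mul] at hRS
    rw [le_div_iff₀ hc', mul_comm]
    exact hRS
  · intro h
    have hm := h (max N₁ N₂) le_rfl
    refine D.norm_integral_le_of_riemannSum hf hb hε hN (n := max N₁ N₂) (le_max_left _ _) ?_
    rw [hfac _ (le_max_right _ _), norm_mul]
    rw [le_div_iff₀ hc', mul_comm] at hm
    exact hm

/-- **Receptacle, robust form: factorisation UP TO `η`** — from level `N` on, `‖RS_m f − c·S_m‖ ≤ η` (the frame-level
formula need only hold modulo the target precision).  A receptacle with explicit binders — nothing is asserted. -/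
def RiemannSumFactorisationUpTo (D : GroupDistribution 𝒰 𝕜) (f : G → 𝕜) (c : 𝕜) (S : ℕ → 𝕜) (N : ℕ) (η : ℝ) :
    Prop :=
  ∀ m, N ≤ m → ‖D.riemannSum f m - c * S m‖ ≤ η

omit [CompleteSpace 𝕜] [IsUltrametricDist 𝕜] in
/-- Exact factorisation is the case `η = 0` (and hence every `η ≥ 0`). -/
theorem RiemannSumFactorisation.upTo {D : GroupDistribution 𝒰 𝕜} {f : G → 𝕜} {c : 𝕜} {S : ℕ → 𝕜} {N : ℕ}
    (h : RiemannSumFactorisation D f c S N) {η : ℝ} (hη : 0 ≤ η) : RiemannSumFactorisationUpTo D f c S N η := by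
  intro m hm; rw [h m hm, sub_self, norm_zero]; exact hη

/-- ★ **`‖∫ f dD‖ ≤ ε` ⟺ «eventually `‖S_m‖ ≤ ε/‖c‖`»** already under a factorisation UP TO the target precision `ε`
(ultrametric: the error term is absorbed, both directions). -/
theorem norm_integral_le_iff_column_upTo (D : GroupDistribution 𝒰 𝕜) {f : G → 𝕜}
    (hf : 𝒰.IsTowerContinuous f) (hb : D.bound ≤ 1) {ε : ℝ} (hε : 0 ≤ ε) {N₁ : ℕ}
    (hN : ∀ n, N₁ ≤ n → ∀ σ τ : G, 𝒰.proj n σ = 𝒰.proj n τ → ‖f σ - f τ‖ ≤ ε)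
    {c : 𝕜} {S : ℕ → 𝕜} {N₂ : ℕ} (hfac : RiemannSumFactorisationUpTo D f c S N₂ ε) (hc : c ≠ 0) :
    ‖D.integral f‖ ≤ ε ↔ ∀ m, max N₁ N₂ ≤ m → ‖S m‖ ≤ ε / ‖c‖ := by
  have hc' : 0 < ‖c‖ := norm_pos_iff.mpr hc
  constructor
  · intro hI m hm
    have hRS := D.norm_riemannSum_le_of_integral hf hb hε hN hI (le_of_max_le_left hm)
    have he := hfac m (le_of_max_le_right hm)
    have h2 := IsUltrametricDist.norm_add_le_max (D.riemannSum f m) (-(D.riemannSum f m - c * S m))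
    rw [norm_neg, ← sub_eq_add_neg, sub_sub_cancel, norm_mul] at h2
    rw [le_div_iff₀ hc', mul_comm]
    exact h2.trans (max_le hRS he)
  · intro h
    have hm := h (max N₁ N₂) le_rfl
    rw [le_div_iff₀ hc', mul_comm] at hm
    have he := hfac (max N₁ N₂) (le_max_right _ _)
    refine D.norm_integral_le_of_riemannSum hf hb hε hN (n := max N₁ N₂) (le_max_left _ _) ?_
    have h2 := IsUltrametricDist.norm_add_le_max (D.riemannSum f (max N₁ N₂) - c * S (max N₁ N₂))
      (c * S (max N₁ N₂))
    rw [sub_add_cancel, norm_mul] at h2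
    exact h2.trans (max_le he hm)

end Column

end Summit.BirchSwinnertonDyer.Rank1Residual.P2.FiniteLevel

end
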